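import Literature.Topology.FourManifolds.TautFoliationsCollarImage
import Literature.Topology.PlanarFoliations.BandOpen
import Literature.Topology.PlanarFoliations.CirclePowers
import HarnessLib

/-!
# The compact contour leaf of the coned collar is essential when the level is not null

Topic: the coned fence collar, plan (d) F5. With the data of `TautFoliationsCollarImage.lean`
(cone position of the collar disc keeping `G` on the outer-collar edges, generic radius `R`,
crossing enumeration, squares along the ring), let `E` be the (compact) leaf of the contour
foliation through the first crossing point `p₀ = ringParam c₀ R 0`. The loop `δ` of
`exists_fillLoop_homotopic` runs in `E` (`ringLevel_subset_leaf_chain`), is continuous in the leaf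
topology (`E` is compact, hence closed: `continuous_toLeaf_of_isClosed`), and its filled image is
homotopic to the horizontal loop of the fence at the level `τR` of `R`. **If `E` were image-null,
the filled image of every loop of `E` would be null** (`ImageNull.map_loop` with
`CircleLoops.map_homotopic_refl_of_map_loop'`), so the level `τR` would be a null level of the
fence. Hence: `¬ NullLevel τR → ¬ ImageNull E` (`not_imageNull_of_not_nullLevel`).

* `Foliation.ConePosition.not_imageNull_of_not_nullLevel` (**proved**).

All statements are [folklore].
-/

noncomputable section

open Set Filter Metric Topology Function Real
open scoped unitInterval
open Literature.Topology.PlanarFoliations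

namespace Literature.Topology.FourManifolds

namespace Foliation.ConePosition

open SquareGrid SquareGrid.Grid SquarePolar ConeSquare CollarRadius Partition

variable {B : Type*} [NormedAddCommGroup B] [NormedSpace ℝ B] {M : Type*} [TopologicalSpace M] {F : Foliation B M}
variable {Γ : C(I, F.GermSpace)} {τ₀ ε : ℝ} {Φ : I → ℝ → M} {c₀ : ℝ × ℝ} {L : ℝ} {hL : 0 < L} {G : ℝ × ℝ → M}
variable (P : ConePosition F G c₀ hL)

variable (hΦ : IsFenceOn F Γ τ₀ ε Φ univ) (hcl : ∀ τ ∈ Ioo (τ₀ - ε) (τ₀ + ε), Φ 1 τ = Φ 0 τ) {τ₁ : ℝ}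
  (hτI : uIcc τ₀ τ₁ ⊆ Ioo (τ₀ - ε) (τ₀ + ε)) (h01 : τ₁ ≠ τ₀)
  (hG : ∀ x, L / 2 ≤ dist x c₀ → G x = Φ (angleParam c₀ x) (levelOfParam τ₀ τ₁ (1 - dist x c₀ / L)))
  (hGc : Continuous G) (hn32 : 32 ≤ P.n)
  (hskelT : ∀ q k, P.gr.edge q k '' Icc 0 (2 * P.gr.ℓ) ⊆ {x | 7 * L / 8 ≤ dist x c₀} →
    ∀ s ∈ Icc 0 (2 * P.gr.ℓ), P.skel (P.gr.edge q k s) = G (P.gr.edge q k s))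
  {R : ℝ} (hR : 15 * L / 16 ≤ R)

include hΦ hcl hτI h01 hG hGc hn32 hskelT hR in
/-- **The compact contour leaf through the first crossing point is not image-null when the level
of `R` is not a null level of the fence.** [folklore] -/
theorem not_imageNull_of_not_nullLevel (ho : F.IsTransverselyOriented) (hvert : ∀ v ∈ P.gr.vertices, dist v c₀ ≠ R)
    (hRL : R + 2 * P.gr.ℓ < L) {N : ℕ} (hN : 0 < N) {θs : Fin (N + 1) → ℝ} (hmono : StrictMono θs) (h0 : θs 0 = 0)
    (hlast : θs (Fin.last N) = 1) (hskel : ∀ j, ringParam c₀ R (θs j) ∈ P.gr.skeleton) {Qs : Fin N → Fin P.n × Fin P.n}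
    (hQs : ∀ j : Fin N, ringParam c₀ R '' piece θs j ⊆ P.gr.sq (Qs j))
    (hy₀X : ringParam c₀ R 0 ∈ (P.gr.X₀ : Set (ℝ × ℝ))) (hnot : ¬ hΦ.NullLevel (levelOfParam τ₀ τ₁ (1 - R / L))) :
    ¬ ImageNull (P.isFoliatedMap_fill ho) (⟨ringParam c₀ R 0, hy₀X⟩ : P.gr.X₀) := by
  intro himg
  have hL' : 0 < L := hL
  have hR0 : 0 < R := by linarith
  haveI := P.gr.nonempty_X₀
  set Fc := P.contourFol ho with hFc
  set hf := P.isFoliatedMap_fill ho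
  set y₀ : P.gr.X₀ := ⟨ringParam c₀ R 0, hy₀X⟩ with hy₀
  -- the homotopy of the horizontal loop with the filled loop `δ`
  obtain ⟨hτR, hclR, δ, ℓ₂, hδc, hδmem, hδ0, hδ1, hℓ₂, hhom⟩ :=
    P.exists_fillLoop_homotopic hΦ hcl hτI h01 hG hGc hn32 hskelT hR ho hRL hN hmono h0 hlast hskel hQs rfl
  -- the leaf `E` through `y₀`: compact, containing the contour arcs
  have hWX := P.wigglyRing_subset_X₀ hΦ hcl hτI h01 hG hGc hn32 hskelT hR hvert hRL
  have hlt : ∀ j : Fin N, θs (Fin.castSucc j) < θs j.succ := fun j ↦ hmono (Fin.castSucc_lt_succ (i := j))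
  have hQR : ∀ j : Fin N, (P.gr.sq (Qs j) ∩ sphere c₀ R).Nonempty := fun j ↦
    ⟨_, hQs j ⟨θs (Fin.castSucc j), ⟨le_rfl, (hlt j).le⟩, rfl⟩, mem_sphere.2 (dist_ringParam hR0.le _)⟩
  have hringW : ∀ j : Fin N, P.ringLevel (Qs j) R ⊆ P.wigglyRing R := fun j x hx ↦ mem_iUnion₂.2 ⟨Qs j, hQR j, hx⟩
  have hδX : ∀ θ, δ θ ∈ (P.gr.X₀ : Set (ℝ × ℝ)) := fun θ ↦ by
    obtain ⟨j, hj⟩ := hδmem θ; exact hWX _ (hringW j hj)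
  have hchain := (P.ringLevel_subset_leaf_chain hΦ hcl hτI h01 hG hGc hn32 hskelT hR ho hvert hRL hR0 hmono h0 hskel hQs hy₀X).2
  have hδE : ∀ θ, (⟨δ θ, hδX θ⟩ : P.gr.X₀) ∈ Fc.leaf y₀ := fun θ ↦ by
    obtain ⟨j, hj⟩ := hδmem θ; exact hchain j _ hj _
  have hy₀W : (y₀ : ℝ × ℝ) ∈ P.wigglyRing R := by
    obtain ⟨q, hq⟩ := (P.gr.mem_skeleton_iff).1 (h0 ▸ hskel 0)
    exact P.mem_wigglyRing_of_mem_sphere hΦ hcl hτI h01 hG hGc hn32 hskelT hR hq (dist_ringParam hR0.le 0)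
  have hEc : IsCompact (Fc.leaf y₀) := P.isCompact_leaf_of_mem_wigglyRing hΦ hcl hτI h01 hG hGc hn32 hskelT hR ho hvert hRL y₀ hy₀W
  have hEcl : IsClosed (Fc.leaf y₀) := hEc.isClosed
  haveI : CompactSpace (Fc.Leaf y₀) := compactSpace_leaf_of_isCompact hEc
  -- the loop `δ` in the leaf topology
  have hδXc : Continuous fun θ : I ↦ (⟨⟨δ θ, hδX θ⟩, hδE θ⟩ : Fc.leaf y₀) :=
    ((hδc.comp_continuous continuous_subtype_val fun θ ↦ θ.2).subtype_mk _).subtype_mk _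
  set δL : I → Fc.Leaf y₀ := fun θ ↦ Leaf.mk (⟨δ θ, hδX θ⟩ : P.gr.X₀) (hδE θ) with hδL
  have hδLc : Continuous δL := (Fc.continuous_toLeaf_of_isClosed hEcl).comp hδXc
  set p₀ : Fc.Leaf y₀ := Leaf.mk y₀ (Fc.mem_leaf_self y₀) with hp₀
  have hends : ∀ {θ : I}, δ θ = ringParam c₀ R 0 → δL θ = p₀ := fun {θ} h ↦ by
    apply Subtype.ext; apply congrArg toLeafSpace; exact Subtype.ext h
  set hpath : Path p₀ p₀ :=
    { toFun := δL
      continuous_toFun := hδLc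
      source' := hends hδ0
      target' := hends hδ1 } with hhpath
  -- the image of `hpath` is `ℓ₂`
  set Φf : C(Fc.Leaf y₀, F.LeafSpace) :=
    ⟨fun q ↦ leafMap Fc F (fun y : P.gr.X₀ ↦ P.fill P.apex (y : ℝ × ℝ)) (q : Fc.LeafSpace),
      hf.continuous_leafMap.comp continuous_subtype_val⟩ with hΦf
  have hval : ∀ θ, Φf (hpath θ) = ℓ₂ θ := fun θ ↦ by rw [hℓ₂ θ]; rfl
  have e : Φf p₀ = (toLeafSpace (Φ 0 (levelOfParam τ₀ τ₁ (1 - R / L))) : F.LeafSpace) := by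
    have h := hval 0
    rw [hpath.source, ℓ₂.source] at h
    exact h
  have hmap : hpath.map Φf.continuous = ℓ₂.cast e e := by
    ext θ
    rw [Path.map_coe, Path.cast_coe, comp_apply]
    exact hval θ
  -- image-null: the image of every loop of the leaf is null
  obtain ⟨β₀, hβ₀c, hβ₀p, hβ₀i, hβ₀s⟩ := exists_leafLoop (x := y₀) (P.isBiOriented_contourFol ho)
  obtain ⟨β, hβc, hβp, hβi, hβs, hβ0⟩ := exists_rebase hβ₀c hβ₀p hβ₀i hβ₀s p₀
  have hnullβ := himg.map_loop β hβc hβp hβi (Fc.mem_leaf_self y₀)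
  have hnullβ' : ((CircleLoops.loop hβc hβp).map Φf.continuous).Homotopic (Path.refl _) := by
    have heq : (CircleLoops.loop hβc hβp).map Φf.continuous =
        (Fc.leafLoop (loopPath β hβc hβp) (continuous_toLeafSpace_loopPath β hβc hβp)).map hf.continuous_leafMap := by
      ext θ; rfl
    rw [heq]; exact hnullβ
  have hnullh : (hpath.map Φf.continuous).Homotopic (Path.refl _) :=
    CircleLoops.map_homotopic_refl_of_map_loop' hβc hβp hβi hβs Φf hnullβ' hβ0.symm hpath
  -- hence `ℓ₂`, and the horizontal loop, are null: the level is null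
  have hℓ₂null : ℓ₂.Homotopic (Path.refl _) := by
    refine CircleLoops.homotopic_of_cast e e ?_
    rw [← hmap]
    have hrefl : (Path.refl (toLeafSpace (Φ 0 (levelOfParam τ₀ τ₁ (1 - R / L))) : F.LeafSpace)).cast e e = Path.refl (Φf p₀) := by
      ext θ; exact e.symm
    rw [hrefl]; exact hnullh
  exact hnot ⟨hτR, hclR, hhom.trans hℓ₂null⟩

end Foliation.ConePosition

end Literature.Topology.FourManifolds
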